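import Mathlib
import Summits.MatrixMultiplication.MatrixMultiplication.Theses.LevelGradedCohnUmans
import Literature.Barriers.MatrixMultiplication.QuasirandomBarrier
import Literature.Barriers.MatrixMultiplication.QuasirandomBarrierProofs
import Summits.MatrixMultiplication.MatrixMultiplication.Theorems.LevelGradedCohnUmansSepImpliesTPP

/-!
# `GradedDesignFamily` (crux stmt-MatrixMultiplication-7610), line `quadratic-extension-level-one-cell`:
# the quasirandom Q-filter obeyed by every graded design

Every graded Cohn–Umans design is a TPP triple, so it is capped by the ambient group's
quasirandomness, whatever the test space.  Precisely: if `X, Y, Z ⊆ G` are `J`-separated in the sense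
of the crux `GradedDesignFamily` — for every target `(x₀, z₀) ∈ X × Z` some `f ∈ J` reads
`f (x⁻¹ y y'⁻¹ z) = [x = x₀ ∧ y = y' ∧ z = z₀]` on `X × Y × Y × Z` — for ANY set `J ⊆ ℂ^G` of test
functions, and `G` is nonabelian, then

  `|X||Y||Z| ≤ |G|^{3/2}/√n(G) + |G|`,   `n(G) = secondCharDegree G`

(`sep_volume_le_quasirandom`, the registered stub; `sep_volume_le_quasirandom_submodule` for a test
SPACE `J ≤ ℂ^G` as in the crux).  The proof is the composite of two tree theorems: `J`-separation
implies the triple product property (route item `SepImpliesTPP`, proved as `SepImpliesTPP_proof`: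
evaluate the separator of the target `(s, u')` at `(s, t, t, u')` and at `(s', t, t', u)`), and
Blasiak–Cohn–Grochow–Pratt–Umans 2023, Thm 3.2 (`BCGPU2023_thm32_holds`, PROVED in the tree by
non-abelian Fourier inversion and Parseval).  The effective Cor. 3.3 form for groups with
`n(G) ≥ c·|G|^δ` is `sep_volume_le_of_minDegree`.

Use ("Q-filter", strategist census gen 1, R2a).  Write the volume of a design as `λ·D^{3/2}` with `D`
the dimension of the test space (or its block mass `Σ_{χ ∈ Irr G ∩ J} χ(1)² ≤ dim J`).  Since
`n(G)² ≤ Σ_χ χ(1)² = |G|`, the additive `|G|` is at most the main term, so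
`λ·D^{3/2} ≤ 2·|G|^{3/2}/√n(G)`, i.e. `D ≤ 4^{1/3}·|G|·(λ² n(G))^{-1/3}` — to leading order
`D ≤ |G|·(λ²·n(G))^{-1/3}`: a design with `λ` bounded below in a quasirandom group (`n(G) → ∞`) must
live on a test space that is a VANISHING fraction of `ℂ^G`, and at full budget `J = ℂ^G` (`D = |G|`)
one recovers BCGPU 2023 Cor. 3.3/3.4 (`λ ≤ 2·n(G)^{-1/2} → 0`: no packing-bound families in
quasirandom groups, in particular none in Lie-type groups of bounded rank).

Sorry-free; axioms `propext`, `Classical.choice`, `Quot.sound`.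
-/

set_option linter.dupNamespace false

open Literature.Combinatorics.Additive Literature.Barriers.MatrixMultiplication

namespace Summit.MatrixMultiplication.MatrixMultiplication.Theorems.GradedDesignFamily.Negative

/-- **Quasirandom Q-filter for graded designs** (registered stub of crux
`stmt-MatrixMultiplication-7610`, line `quadratic-extension-level-one-cell`).  If `X, Y, Z ⊆ G` are
`J`-separated (for every target `(x₀, z₀) ∈ X × Z` some `f ∈ J` has
`f (x⁻¹ y y'⁻¹ z) = [x = x₀ ∧ y = y' ∧ z = z₀]` on `X × Y × Y × Z`), for an arbitrary set `J` of test
functions, and `G` is a finite nonabelian group, then `|X||Y||Z| ≤ |G|^{3/2}/√n(G) + |G|` with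
`n(G) = secondCharDegree G` the least degree `> 1` of an irreducible character.  Separation implies the
triple product property (`SepImpliesTPP_proof`), and TPP triples obey BCGPU 2023 Thm 3.2
(`BCGPU2023_thm32_holds`). [cite: BlasiakCohnGrochowPrattUmans2023, Thm. 3.2] -/
theorem sep_volume_le_quasirandom {G : Type} [Group G] [Fintype G]
    (J : Set (G → ℂ)) (X Y Z : Finset G)
    (hsep : ∀ x₀ ∈ X, ∀ z₀ ∈ Z, ∃ f ∈ J, ∀ x ∈ X, ∀ y ∈ Y, ∀ y' ∈ Y, ∀ z ∈ Z,
      (x = x₀ ∧ y = y' ∧ z = z₀ → f (x⁻¹ * y * y'⁻¹ * z) = 1) ∧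
      (¬ (x = x₀ ∧ y = y' ∧ z = z₀) → f (x⁻¹ * y * y'⁻¹ * z) = 0))
    (hG : ∃ a b : G, a * b ≠ b * a) :
    ((X.card * Y.card * Z.card : ℕ) : ℝ) ≤
      (Fintype.card G : ℝ) ^ (3 / 2 : ℝ) /
        Real.sqrt (Literature.Barriers.MatrixMultiplication.secondCharDegree G) + Fintype.card G :=
  BCGPU2023_thm32_holds G hG X Y Z
    (Summit.MatrixMultiplication.MatrixMultiplication.Theorems.SepImpliesTPP_proof G J X Y Z hsep)

/-- **Quasirandom Q-filter, test-space form.**  The same bound for a test SPACE `J ≤ ℂ^G`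
(a `ℂ`-submodule of `G → ℂ`, as in the crux `GradedDesignFamily`; no invariance of `J` is needed):
a `J`-separated triple in a finite nonabelian group has `|X||Y||Z| ≤ |G|^{3/2}/√n(G) + |G|`.

Consequence (the Q-filter every graded design must pass).  Write the volume as
`|X||Y||Z| = λ·D^{3/2}`, where `D = dim J` (`= Σ_{χ ∈ Irr G ∩ J} χ(1)²`, the block mass, for
the bi-invariant `J` of the crux; beating the graded budget `Σ_{χ ∈ Irr G ∩ J} χ(1)^{2+ε} ≥ D` at
exponent `2 + ε` needs `λ^{(2+ε)/3} > D^{-ε/2}`).  Because `n(G)` is itself a character degree,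
`n(G)² ≤ Σ_χ χ(1)² = |G|`, so the additive term is dominated by the main one
(`|G| ≤ |G|^{5/4} ≤ |G|^{3/2}/√n(G)`) and the bound gives `λ·D^{3/2} ≤ 2·|G|^{3/2}/√n(G)`, that is
`D ≤ 4^{1/3}·|G|·(λ²·n(G))^{-1/3}`; to leading order (dropping the additive `|G|`)
`D ≤ |G|·(λ²·n(G))^{-1/3}`.  So in quasirandom groups (`n(G) → ∞`, e.g. Lie-type groups of bounded
rank, `n(SL₂(F_Q)) ≥ (Q−1)/2`) a design of non-negligible `λ` can only live on a test space
occupying a vanishing fraction `(λ² n(G))^{-1/3}` of `ℂ^G`; at full budget `D = |G|` this is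
BCGPU 2023 Cor. 3.3 (`λ ≤ 2·n(G)^{-1/2}`: no packing-bound families).
[cite: BlasiakCohnGrochowPrattUmans2023, Thm. 3.2] -/
theorem sep_volume_le_quasirandom_submodule {G : Type} [Group G] [Fintype G]
    (J : Submodule ℂ (G → ℂ)) (X Y Z : Finset G)
    (hsep : ∀ x₀ ∈ X, ∀ z₀ ∈ Z, ∃ f ∈ J, ∀ x ∈ X, ∀ y ∈ Y, ∀ y' ∈ Y, ∀ z ∈ Z,
      (x = x₀ ∧ y = y' ∧ z = z₀ → f (x⁻¹ * y * y'⁻¹ * z) = 1) ∧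
      (¬ (x = x₀ ∧ y = y' ∧ z = z₀) → f (x⁻¹ * y * y'⁻¹ * z) = 0))
    (hG : ∃ a b : G, a * b ≠ b * a) :
    ((X.card * Y.card * Z.card : ℕ) : ℝ) ≤
      (Fintype.card G : ℝ) ^ (3 / 2 : ℝ) /
        Real.sqrt (Literature.Barriers.MatrixMultiplication.secondCharDegree G) + Fintype.card G :=
  sep_volume_le_quasirandom (J : Set (G → ℂ)) X Y Z hsep hG

/-- **Quasirandom Q-filter, effective minimal-degree form** (BCGPU 2023 Cor. 3.3 for designs).  If
`n(G) ≥ c·|G|^δ` with `c > 0`, then every `J`-separated triple of the finite nonabelian group `G` has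
`|X||Y||Z| ≤ |G|^{3/2 − δ/2}/√c + |G|` — bounded away from the packing bound `|G|^{3/2 − o(1)}`
(separation implies the TPP, `SepImpliesTPP_proof`; then `BCGPU2023_thm32.cor33` on the proved
Thm 3.2). [cite: BlasiakCohnGrochowPrattUmans2023, Cor. 3.3] -/
theorem sep_volume_le_of_minDegree {G : Type} [Group G] [Fintype G]
    (J : Set (G → ℂ)) (X Y Z : Finset G)
    (hsep : ∀ x₀ ∈ X, ∀ z₀ ∈ Z, ∃ f ∈ J, ∀ x ∈ X, ∀ y ∈ Y, ∀ y' ∈ Y, ∀ z ∈ Z,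
      (x = x₀ ∧ y = y' ∧ z = z₀ → f (x⁻¹ * y * y'⁻¹ * z) = 1) ∧
      (¬ (x = x₀ ∧ y = y' ∧ z = z₀) → f (x⁻¹ * y * y'⁻¹ * z) = 0))
    (hG : ∃ a b : G, a * b ≠ b * a) {c δ : ℝ} (hc : 0 < c)
    (hn : c * (Fintype.card G : ℝ) ^ δ ≤ Literature.Barriers.MatrixMultiplication.secondCharDegree G) :
    ((X.card * Y.card * Z.card : ℕ) : ℝ) ≤
      (Fintype.card G : ℝ) ^ (3 / 2 - δ / 2 : ℝ) / Real.sqrt c + Fintype.card G :=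
  BCGPU2023_thm32_holds.cor33 G hG hc hn X Y Z
    (Summit.MatrixMultiplication.MatrixMultiplication.Theorems.SepImpliesTPP_proof G J X Y Z hsep)

end Summit.MatrixMultiplication.MatrixMultiplication.Theorems.GradedDesignFamily.Negative
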